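import Summits.QuantumFields.YangMills.Theorems.BalabanUVNodesN09HregOfFibredChartAtRecord
import Literature.MathematicalPhysics.QuantumFieldTheory.Balaban1983to89.Node00.RegSetOfLocalFaces

/-!
# NODE N09 [B12] — THE ANALYTIC INCLUSION `hreg` OF THE THEOREM-3 DOORS AT THE STAGE-13 RECORD FROM PER-STEP FLAT LOCAL FACES OF
# THE CHART-READ AVERAGING OF RECORD (the LOCAL road: no global fibred chart), and dag-n09-w4 g3's small-field-bookkeeping door with
# `hreg` REPLACED by those faces

Cell `pub-ymgap` (YM-PLAN Track A), width seat `pub-ymgap-dag-n09-w2` g4 (node N09); helper of K1⁸ `StabilityBRunRowsAtRecordR13SepCoPH` =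
stmt-QuantumFields-26907 (`--supports`, `--as helper`, count-neutral; lineage of the K1⁷ 20542 helpers).  [I] = [Balaban1987RG1].

WHY.  N09's Theorem-3 member at the Stage-13 record, in dag-n09-w3 g2's door with the small-field domains as bookkeeping sets and dag-n09-w4
g3's rider discharge (`…N09B0RiderAtRecord.thm3Member_stage13SepCoPH_atDomAlt_of_numerics_of_εreg_eq`), displays the analytic inclusion
`hreg : ∀ j < K, domAlt_{j+1} ⊆ regSetOfRecord K j ρ_j`.  The SIBLING file `…N09HregOfFibredChartAtRecord` (dag-n09-w6 g2, p611241) derives it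
from ONE global fibred chart per step (print's (2.10) substitution read as a change of variables; ROAD A).  THIS FILE derives it on ROAD B,
the LOCAL road of this seat's g3∕g4 files: per step `j < K` and per fine configuration `U₀` of a closed set `K₀ j` carrying `ρ_j`, the FLAT
local «Jacobian face» of the chart-read averaging `A ↦ (c ↦ Λ(Ū(Θ^B(A)·U₀)(c)·Ū(U₀)(c)⁻¹))` at `0` (bond-wise exponential charts of `SU(N)`),
glued over the compact configuration space (`Literature/MeasureTheory/Integral/PushforwardDensityGluing` + `…ChartTransport` +
`Balaban1983to89/HaarExpChartLocalFaceTransport` + `Node00/RegSetOfLocalFaces`, all by name).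

WHAT IS PROVED (0 def, 0 sorry).
* ★★ `hreg_of_flatLocalFaces` — the binder `hreg` VERBATIM (all `j < P.K`) from, per step: `ρ_j` measurable, `0 ≤ ρ_j ≤ C_j`, vanishing
  off a closed `K₀ j`, continuous at each `U ∈ K₀ j` with `Q j U` (an exemption predicate — at the record's sharp (2.9) χ the exempt set is
  the threshold set); at every `U₀ ∈ K₀ j` continuity of `(avOfRecord F N P.K j).avg` and the flat local face of its chart reading at `0`
  (the conclusion shape of `SubmersionPushforward…` for `Q ≡ True`, of `AnalyticSubmersion…_sharp` in general).
* ★★ `hreg_of_engineFaces` — the same fed by the C¹ ENGINE's own output shape per fine configuration (dag-n09-w4 g5's announced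
  `flatLocalFace_chartRead_avOfRecord`), for `ρ_j` continuous at EVERY point of `K₀ j` — HONEST: this variant serves CONTINUOUS cut-offs;
  at the record's SHARP χ the continuity clause fails at the threshold configurations and the general-`Q` variant above (sharp engine +
  transversality at the thresholds, located-open) is the one that applies.
* ★★★ `thm3Member_stage13SepCoPH_atDomAlt_of_flatLocalFaces_of_numerics_of_εreg_eq` — dag-n09-w4 g3's door with `hreg` GONE in favour of
  the per-step local-face data (general `Q`); (I19) integrability `hint` is DERIVED from boundedness + measurability.
* (v1.1) `hreg_of_flatLocalFaces'`, `thm3Member_stage13SepCoPH_atDomAlt_of_sharpFlatLocalFaces_of_numerics_of_εreg_eq` — the same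
  from SHARP-FORM flat faces (the input shape that survives window cuts, `HaarExpChartLocalFaceTransport` §8).

HONEST FRAMING.  Count-neutral RE-SHAPING of ONE displayed hypothesis (∃ continuous version ↦ ∃ flat local faces per fine configuration),
kernel bookkeeping BY NAME; the faces are NOT constructed here ((M3r)-local — dag-n09-w4 g5's claim for `Q ≡ True`; the thresholds'
transversality for the sharp χ — located-open); NOTHING of Bałaban's asserted ([B11] Thm 1, numerics, (181)ˢᵒˡ stay hypotheses); NO carrier
re-pointed; A6: no inhabitant at the V18∕V19 witness claimed; N09 NOT discharged; conjunct 1 (Lemma 4) and FLAG №7 untouched; K0⁷ ∕ K1⁸ ∕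
K3⁷ NOT closed; counts unmoved (typed 28∕28 · discharged 5∕28); one finite four-torus programme at fixed `ε = L^{−K}` per run — R4 closes the
conditional rung `BalabanLadder.UV` only; NOT ℝ⁴ ∕ infinite volume ∕ OS; the Yang–Mills mass gap (Clay) is NOT proved by any of this.
-/

noncomputable section

namespace Summit.QuantumFields.YangMills.BalabanUVNodes.N09HregOfLocalFacesAtRecord

open MeasureTheory Set
open scoped ENNReal NNReal Matrix.Norms.L2Operator
open Literature.MathematicalPhysics.QuantumFieldTheory.Balaban1983to89
open Literature.MathematicalPhysics.QuantumFieldTheory.Balaban1983to89.T4Continuum (T4Family)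
open Literature.MathematicalPhysics.QuantumFieldTheory.Balaban1983to89.DagBinding (WorldP leavesP)
open Literature.MathematicalPhysics.QuantumFieldTheory.Balaban1983to89.Node00
open Literature.MathematicalPhysics.QuantumFieldTheory.Balaban1983to89.Node00.RegSetOfLocalFaces
open Literature.MathematicalPhysics.QuantumFieldTheory.Balaban1983to89.HaarExponentialChart
open Literature.MathematicalPhysics.QuantumFieldTheory.Balaban1983to89.B12RTGaugeInvariance254 (liftTransf)
open Literature.MathematicalPhysics.QuantumFieldTheory.Balaban1983to89.GaugeField (gaugeAct)
open Literature.MathematicalPhysics.QuantumFieldTheory.Balaban1983to89.ExpMeanLog (deltaSU)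
open Literature.MathematicalPhysics.QuantumFieldTheory.Balaban1983to89.B12ContinuousTransportInvarianceOn (isOpen_domAltOfRecord)
open N09B0RiderAtRecord (thm3Member_stage13SepCoPH_atDomAlt_of_numerics_of_εreg_eq)

variable {F : T4Family} {N : ℕ} [NeZero N]
variable [MeasurableSpace (specialUnitaryLogChart (Fin N)).lie] [BorelSpace (specialUnitaryLogChart (Fin N)).lie]

/-- ★★ **THE ANALYTIC INCLUSION `hreg` FROM PER-STEP FLAT LOCAL FACES (ROAD B).**  For a Stage-13 parameter `θ`, a run `P`, an additive Haar
measure `η` on the Lie model, exemption predicates `Q j` and closed sets `K₀ j` of fine configurations: if every β-input density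
`ρ_j = betaInputOfRecord (TβOfRecord₁₃) (chiβOfRecord₁₃ θ) P.K (gOfRecord₁₃ θ P) j`, `j < P.K`, is measurable, `0 ≤ ρ_j ≤ C_j`, vanishes off
`K₀ j` and is continuous at each `U ∈ K₀ j` with `Q j U`, and at every `U₀ ∈ K₀ j` the averaging of record is continuous with the FLAT local face of
its chart reading at `0` (w.r.t. `⊗η`), then `domAltOfRecord θ.ν P.K (j+1) ⊆ regSetOfRecord F N P.K j ρ_j` for every `j < P.K` — the binder `hreg`
of the N09 doors VERBATIM (`Node00.RegSetOfLocalFaces.subset_regSetOfRecord_of_flatLocalFaces` at the open set `domAltOfRecord`).  The faces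
are displayed, not constructed. [cite: Balaban1987RG1, p.259, (2.10) p.267 and (0.13) p.254] -/
theorem hreg_of_flatLocalFaces (θ : Stage13Params F N) (P : B12.RunParams)
    (η : Measure (specialUnitaryLogChart (Fin N)).lie) [η.IsAddHaarMeasure]
    (Q : ∀ j, GaugeField (F.P P.K) j (SU N) → Prop) (K₀ : ∀ j, Set (GaugeField (F.P P.K) j (SU N))) (hK₀ : ∀ j, IsClosed (K₀ j))
    (hρm : ∀ j < P.K, Measurable (betaInputOfRecord F N (TβOfRecord₁₃ F N) (chiβOfRecord₁₃ F N θ) P.K (gOfRecord₁₃ F N θ P) j))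
    (hρ0 : ∀ j < P.K, ∀ U, 0 ≤ betaInputOfRecord F N (TβOfRecord₁₃ F N) (chiβOfRecord₁₃ F N θ) P.K (gOfRecord₁₃ F N θ P) j U)
    (hρC : ∀ j < P.K, ∃ C₀ : ℝ, ∀ U, betaInputOfRecord F N (TβOfRecord₁₃ F N) (chiβOfRecord₁₃ F N θ) P.K (gOfRecord₁₃ F N θ P) j U ≤ C₀)
    (hρK : ∀ j < P.K, ∀ U, U ∉ K₀ j → betaInputOfRecord F N (TβOfRecord₁₃ F N) (chiβOfRecord₁₃ F N θ) P.K (gOfRecord₁₃ F N θ P) j U = 0)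
    (hρc : ∀ j < P.K, ∀ U ∈ K₀ j, Q j U →
      ContinuousAt (betaInputOfRecord F N (TβOfRecord₁₃ F N) (chiβOfRecord₁₃ F N θ) P.K (gOfRecord₁₃ F N θ P) j) U)
    (hface : ∀ j < P.K, ∀ U₀ ∈ K₀ j, ContinuousAt (avOfRecord F N P.K j).avg U₀ ∧
      ∃ O : Set (PBond (F.P P.K) j → (specialUnitaryLogChart (Fin N)).lie),
        ∃ D : Set (PBond (F.P P.K) (j + 1) → (specialUnitaryLogChart (Fin N)).lie),
        IsOpen O ∧ (0 : PBond (F.P P.K) j → (specialUnitaryLogChart (Fin N)).lie) ∈ O ∧ IsOpen D ∧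
        (0 : PBond (F.P P.K) (j + 1) → (specialUnitaryLogChart (Fin N)).lie) ∈ D ∧
        ∀ r : (PBond (F.P P.K) j → (specialUnitaryLogChart (Fin N)).lie) → ℝ, Measurable r → (∀ A, 0 ≤ r A) →
          (∀ A ∈ O, Q j (fun b => (isChartRep_specialUnitaryGroup (n := Fin N)).expChart (A b) * U₀ b) → ContinuousAt r A) →
          (∃ C₀ : ℝ, ∀ A, r A ≤ C₀) → (∀ A, A ∉ O → r A = 0) →
          ∃ I : (PBond (F.P P.K) (j + 1) → (specialUnitaryLogChart (Fin N)).lie) → ℝ, ContinuousOn I D ∧ (∀ w, 0 ≤ I w) ∧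
            ∀ A' : Set (PBond (F.P P.K) (j + 1) → (specialUnitaryLogChart (Fin N)).lie), MeasurableSet A' → A' ⊆ D →
              ((Measure.pi fun _ : PBond (F.P P.K) j => η).withDensity fun A => ENNReal.ofReal (r A))
                  ((fun (A : PBond (F.P P.K) j → (specialUnitaryLogChart (Fin N)).lie) (c : PBond (F.P P.K) (j + 1)) =>
                      (isChartRep_specialUnitaryGroup (n := Fin N)).logChart
                        ((avOfRecord F N P.K j).avg
                            (fun b => (isChartRep_specialUnitaryGroup (n := Fin N)).expChart (A b) * U₀ b) c *
                          ((avOfRecord F N P.K j).avg U₀ c)⁻¹)) ⁻¹' A') =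
                ∫⁻ w in A', ENNReal.ofReal (I w) ∂(Measure.pi fun _ : PBond (F.P P.K) (j + 1) => η)) :
    ∀ j < P.K, domAltOfRecord F N θ.ν P.K (j + 1) ⊆ regSetOfRecord F N P.K j
      (betaInputOfRecord F N (TβOfRecord₁₃ F N) (chiβOfRecord₁₃ F N θ) P.K (gOfRecord₁₃ F N θ P) j) :=
  fun j hj => subset_regSetOfRecord_of_flatLocalFaces η hj (hρm j hj) (hρ0 j hj) (hρC j hj) (Q j) (hK₀ j) (hρK j hj) (hρc j hj)
    (hface j hj) (isOpen_domAltOfRecord θ.ν P.K (j + 1))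

/-- ★★ **THE SAME FED BY THE C¹ ENGINE'S OWN OUTPUT** (per fine configuration: the conclusion of
`SubmersionPushforward.exists_continuousOn_density_map_of_submersion` for the chart-read averaging at `a = 0` — dag-n09-w4 g5's announced
`flatLocalFace_chartRead_avOfRecord`), for β-input densities CONTINUOUS AT EVERY POINT of the closed sets `K₀ j`.  HONEST: this variant serves
continuous cut-offs; at the record's sharp (2.9) χ the continuity clause fails at the threshold configurations — there `hreg_of_flatLocalFaces`
with the threshold exemption `Q` (sharp engine + transversality, located-open) is the applicable form.
[cite: Balaban1987RG1, p.259, (2.10) p.267 and (0.13) p.254] -/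
theorem hreg_of_engineFaces (θ : Stage13Params F N) (P : B12.RunParams)
    (η : Measure (specialUnitaryLogChart (Fin N)).lie) [η.IsAddHaarMeasure]
    (K₀ : ∀ j, Set (GaugeField (F.P P.K) j (SU N))) (hK₀ : ∀ j, IsClosed (K₀ j))
    (hρm : ∀ j < P.K, Measurable (betaInputOfRecord F N (TβOfRecord₁₃ F N) (chiβOfRecord₁₃ F N θ) P.K (gOfRecord₁₃ F N θ P) j))
    (hρ0 : ∀ j < P.K, ∀ U, 0 ≤ betaInputOfRecord F N (TβOfRecord₁₃ F N) (chiβOfRecord₁₃ F N θ) P.K (gOfRecord₁₃ F N θ P) j U)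
    (hρC : ∀ j < P.K, ∃ C₀ : ℝ, ∀ U, betaInputOfRecord F N (TβOfRecord₁₃ F N) (chiβOfRecord₁₃ F N θ) P.K (gOfRecord₁₃ F N θ P) j U ≤ C₀)
    (hρK : ∀ j < P.K, ∀ U, U ∉ K₀ j → betaInputOfRecord F N (TβOfRecord₁₃ F N) (chiβOfRecord₁₃ F N θ) P.K (gOfRecord₁₃ F N θ P) j U = 0)
    (hρc : ∀ j < P.K, ∀ U ∈ K₀ j,
      ContinuousAt (betaInputOfRecord F N (TβOfRecord₁₃ F N) (chiβOfRecord₁₃ F N θ) P.K (gOfRecord₁₃ F N θ P) j) U)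
    (hengine : ∀ j < P.K, ∀ U₀ ∈ K₀ j, ContinuousAt (avOfRecord F N P.K j).avg U₀ ∧
      ∃ O : Set (PBond (F.P P.K) j → (specialUnitaryLogChart (Fin N)).lie), IsOpen O ∧
        (0 : PBond (F.P P.K) j → (specialUnitaryLogChart (Fin N)).lie) ∈ O ∧
        ∃ D : Set (PBond (F.P P.K) (j + 1) → (specialUnitaryLogChart (Fin N)).lie), IsOpen D ∧
        (fun A : PBond (F.P P.K) j → (specialUnitaryLogChart (Fin N)).lie =>
            (fun (V : PBond (F.P P.K) (j + 1) → SU N) (c : PBond (F.P P.K) (j + 1)) =>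
              (isChartRep_specialUnitaryGroup (n := Fin N)).logChart (V c * ((avOfRecord F N P.K j).avg U₀ c)⁻¹))
              ((avOfRecord F N P.K j).avg
                (fun b => (isChartRep_specialUnitaryGroup (n := Fin N)).expChart (A b) * U₀ b))) 0 ∈ D ∧
        ∀ r : (PBond (F.P P.K) j → (specialUnitaryLogChart (Fin N)).lie) → ℝ, Measurable r → (∀ A, 0 ≤ r A) →
          ContinuousOn r O → (∃ C₀ : ℝ, ∀ A ∈ O, r A ≤ C₀) → (∀ A, A ∉ O → r A = 0) →
          ∃ I : (PBond (F.P P.K) (j + 1) → (specialUnitaryLogChart (Fin N)).lie) → ℝ, ContinuousOn I D ∧ (∀ w, 0 ≤ I w) ∧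
            ∀ A' : Set (PBond (F.P P.K) (j + 1) → (specialUnitaryLogChart (Fin N)).lie), MeasurableSet A' → A' ⊆ D →
              ((Measure.pi fun _ : PBond (F.P P.K) j => η).withDensity fun A => ENNReal.ofReal (r A))
                  ((fun A : PBond (F.P P.K) j → (specialUnitaryLogChart (Fin N)).lie =>
                      (fun (V : PBond (F.P P.K) (j + 1) → SU N) (c : PBond (F.P P.K) (j + 1)) =>
                        (isChartRep_specialUnitaryGroup (n := Fin N)).logChart (V c * ((avOfRecord F N P.K j).avg U₀ c)⁻¹))
                        ((avOfRecord F N P.K j).avg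
                          (fun b => (isChartRep_specialUnitaryGroup (n := Fin N)).expChart (A b) * U₀ b))) ⁻¹' A') =
                ∫⁻ w in A', ENNReal.ofReal (I w) ∂(Measure.pi fun _ : PBond (F.P P.K) (j + 1) => η)) :
    ∀ j < P.K, domAltOfRecord F N θ.ν P.K (j + 1) ⊆ regSetOfRecord F N P.K j
      (betaInputOfRecord F N (TβOfRecord₁₃ F N) (chiβOfRecord₁₃ F N θ) P.K (gOfRecord₁₃ F N θ P) j) :=
  fun j hj => ((regular_of_engineFaces η hj (hρm j hj) (hρ0 j hj) (hρC j hj) (hK₀ j) (hρK j hj) (hρc j hj) (hengine j hj)).1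
    _ (isOpen_domAltOfRecord θ.ν P.K (j + 1))).1

/-- ★★★ **dag-n09-w4 g3's SMALL-FIELD-BOOKKEEPING DOOR WITH `hreg` REPLACED BY PER-STEP FLAT LOCAL FACES (ROAD B)**
(`…N09B0RiderAtRecord.thm3Member_stage13SepCoPH_atDomAlt_of_numerics_of_εreg_eq` with `hreg := hreg_of_flatLocalFaces …` and (I19) `hint`
derived from boundedness + measurability): N09's Theorem-3 member at the Stage-13 record from (181)ˢᵒˡ `hcov`, `hsolν` + [B11] ×3 at one
radius (N07), NUMERICS on the record's letters, and — in place of the analytic inclusion — per step `j < P.K`: the β-input density measurable,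
`0 ≤ ρ_j ≤ C_j`, vanishing off a closed `K₀ j`, continuous at the non-exempt points, and at every fine configuration of `K₀ j` the FLAT LOCAL
FACE of the chart-read averaging of record at `0` (displayed, not constructed).  CONDITIONAL; nothing of Bałaban's asserted; N09 NOT discharged.
[cite: Balaban1987RG1, Thm 3 p.264, p.259, (2.9) p.266, (2.10) p.267; Balaban1985Variational, Thm 1 (8)–(10) p.279 and (181) p.307] -/
theorem thm3Member_stage13SepCoPH_atDomAlt_of_flatLocalFaces_of_numerics_of_εreg_eq (θ : Stage13HParams F N)
    (h : θ.Provisos₁₃SepCoPH F N)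
    {w : WorldP} (hC : w.C = (datumOfRecord₁₃SepCoPH F N θ h).C) (P : B12.RunParams) (hε : 0 < θ.ε₂₉) (heq : θ.toStage13Params.ν.εreg = θ.εbg)
    (hεreg : 0 < θ.toStage13Params.ν.εreg)
    (hε3 : (143 * (((((F.P P.K).d + 4 : ℕ) : ℝ)) ^ 2 / 4) ^ 2) * θ.toStage13Params.ν.εreg ≤ 1 / 3)
    (hε2 : 2 * θ.toStage13Params.ν.εreg ≤ 2 * deltaSU (Fin N) / ((((F.P P.K).d + 4) * (F.P P.K).L : ℕ) : ℝ) ^ 2)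
    (hord : 2 * θ.toStage13Params.ν.εreg / ((F.P P.K).L : ℝ) ^ 2 +
      4 * max θ.toStage13Params.ε₂₉ (10 * (((((F.P P.K).d + 2) * (F.P P.K).L : ℕ) : ℝ) * θ.toStage13Params.ε₂₉) * ((F.P P.K).L : ℝ) ^ ((F.P P.K).d - 1)) ≤
        θ.toStage13Params.ν.ε₀)
    (hn1 : 1640 * (2 * (((((F.P P.K).d + 2) * (F.P P.K).L : ℕ) : ℝ) * θ.toStage13Params.ε₂₉) +
        ((((F.P P.K).d + 2) * (F.P P.K).L : ℕ) : ℝ) ^ 2 / 4 * (2 * θ.toStage13Params.ν.εreg / ((F.P P.K).L : ℝ) ^ 2)) *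
          (((F.P P.K).L : ℝ) ^ ((F.P P.K).d - 1)) ^ 2 ≤ 1)
    (hn2 : 13 * (2 * (((((F.P P.K).d + 2) * (F.P P.K).L : ℕ) : ℝ) * θ.toStage13Params.ε₂₉) +
        ((((F.P P.K).d + 2) * (F.P P.K).L : ℕ) : ℝ) ^ 2 / 4 * (2 * θ.toStage13Params.ν.εreg / ((F.P P.K).L : ℝ) ^ 2)) *
          ((F.P P.K).L : ℝ) ^ ((F.P P.K).d - 1) < deltaSU (Fin N))
    (hcov : ∀ j < P.K, ∀ (v : GaugeTransf (F.P P.K) (j + 1) (SU N)) (W : GaugeField (F.P P.K) (j + 1) (SU N)),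
      UkExists F N P.K (j + 1) θ.toStage13Params.ν.εreg W →
        critCfgOfRecord F N θ.toStage13Params.ν P.K j (gaugeAct v W) = gaugeAct (liftTransf v) (critCfgOfRecord F N θ.toStage13Params.ν P.K j W))
    (hsolν : ∀ j < P.K, ∀ W ∈ domAltOfRecord F N θ.ν P.K (j + 1), UkExists F N P.K (j + 1) θ.toStage13Params.ν.εreg W)
    (η : Measure (specialUnitaryLogChart (Fin N)).lie) [η.IsAddHaarMeasure]
    (Q : ∀ j, GaugeField (F.P P.K) j (SU N) → Prop) (K₀ : ∀ j, Set (GaugeField (F.P P.K) j (SU N))) (hK₀ : ∀ j, IsClosed (K₀ j))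
    (hρm : ∀ j < P.K, Measurable (betaInputOfRecord F N (TβOfRecord₁₃ F N) (chiβOfRecord₁₃ F N θ.toStage13Params) P.K
      (gOfRecord₁₃ F N θ.toStage13Params P) j))
    (hρ0 : ∀ j < P.K, ∀ U, 0 ≤ betaInputOfRecord F N (TβOfRecord₁₃ F N) (chiβOfRecord₁₃ F N θ.toStage13Params) P.K
      (gOfRecord₁₃ F N θ.toStage13Params P) j U)
    (hρC : ∀ j < P.K, ∃ C₀ : ℝ, ∀ U, betaInputOfRecord F N (TβOfRecord₁₃ F N) (chiβOfRecord₁₃ F N θ.toStage13Params) P.K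
      (gOfRecord₁₃ F N θ.toStage13Params P) j U ≤ C₀)
    (hρK : ∀ j < P.K, ∀ U, U ∉ K₀ j → betaInputOfRecord F N (TβOfRecord₁₃ F N) (chiβOfRecord₁₃ F N θ.toStage13Params) P.K
      (gOfRecord₁₃ F N θ.toStage13Params P) j U = 0)
    (hρc : ∀ j < P.K, ∀ U ∈ K₀ j, Q j U → ContinuousAt (betaInputOfRecord F N (TβOfRecord₁₃ F N)
      (chiβOfRecord₁₃ F N θ.toStage13Params) P.K (gOfRecord₁₃ F N θ.toStage13Params P) j) U)
    (hface : ∀ j < P.K, ∀ U₀ ∈ K₀ j, ContinuousAt (avOfRecord F N P.K j).avg U₀ ∧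
      ∃ O : Set (PBond (F.P P.K) j → (specialUnitaryLogChart (Fin N)).lie),
        ∃ D : Set (PBond (F.P P.K) (j + 1) → (specialUnitaryLogChart (Fin N)).lie),
        IsOpen O ∧ (0 : PBond (F.P P.K) j → (specialUnitaryLogChart (Fin N)).lie) ∈ O ∧ IsOpen D ∧
        (0 : PBond (F.P P.K) (j + 1) → (specialUnitaryLogChart (Fin N)).lie) ∈ D ∧
        ∀ r : (PBond (F.P P.K) j → (specialUnitaryLogChart (Fin N)).lie) → ℝ, Measurable r → (∀ A, 0 ≤ r A) →
          (∀ A ∈ O, Q j (fun b => (isChartRep_specialUnitaryGroup (n := Fin N)).expChart (A b) * U₀ b) → ContinuousAt r A) →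
          (∃ C₀ : ℝ, ∀ A, r A ≤ C₀) → (∀ A, A ∉ O → r A = 0) →
          ∃ I : (PBond (F.P P.K) (j + 1) → (specialUnitaryLogChart (Fin N)).lie) → ℝ, ContinuousOn I D ∧ (∀ w, 0 ≤ I w) ∧
            ∀ A' : Set (PBond (F.P P.K) (j + 1) → (specialUnitaryLogChart (Fin N)).lie), MeasurableSet A' → A' ⊆ D →
              ((Measure.pi fun _ : PBond (F.P P.K) j => η).withDensity fun A => ENNReal.ofReal (r A))
                  ((fun (A : PBond (F.P P.K) j → (specialUnitaryLogChart (Fin N)).lie) (c : PBond (F.P P.K) (j + 1)) =>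
                      (isChartRep_specialUnitaryGroup (n := Fin N)).logChart
                        ((avOfRecord F N P.K j).avg
                            (fun b => (isChartRep_specialUnitaryGroup (n := Fin N)).expChart (A b) * U₀ b) c *
                          ((avOfRecord F N P.K j).avg U₀ c)⁻¹)) ⁻¹' A') =
                ∫⁻ w in A', ENNReal.ofReal (I w) ∂(Measure.pi fun _ : PBond (F.P P.K) (j + 1) => η))
    (h11 : ∀ k, k ≤ P.K → ∀ V ∈ domAltOfRecord F N θ.ν P.K k, UkExists F N P.K k θ.εbg V ∧ UniqueUkOrbit F N P.K k θ.εbg V)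
    (hres : ∀ k, k ≤ P.K → HRestrict F N θ.εbg P.K k (domAltOfRecord F N θ.ν P.K k))
    (huniq : ∀ k, k ≤ P.K → ∀ V ∈ domAltOfRecord F N θ.ν P.K k, ∀ j < k,
      UniqueUkOrbit F N P.K (j + 1) θ.εbg (Averaging.iter (avOfRecord F N P.K) (j + 1) (Uk F N P.K k θ.εbg V))) :
    (leavesP w P).smallCouplings → (leavesP w P).smallFieldInductive := by
  have hint : ∀ j < P.K, Integrable (betaInputOfRecord F N (TβOfRecord₁₃ F N) (chiβOfRecord₁₃ F N θ.toStage13Params) P.K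
      (gOfRecord₁₃ F N θ.toStage13Params P) j) (fieldMeasure (F.P P.K) j (SU N)) := by
    intro j hj
    obtain ⟨C₀, hC₀⟩ := hρC j hj
    refine Integrable.of_bound (hρm j hj).aestronglyMeasurable C₀ (Filter.Eventually.of_forall fun U => ?_)
    rw [Real.norm_eq_abs, abs_of_nonneg (hρ0 j hj U)]
    exact hC₀ U
  exact thm3Member_stage13SepCoPH_atDomAlt_of_numerics_of_εreg_eq θ h hC P hε heq hεreg hε3 hε2 hord hn1 hn2 hcov hsolν hint
    (hreg_of_flatLocalFaces θ.toStage13Params P η Q K₀ hK₀ hρm hρ0 hρC hρK hρc hface) h11 hres huniq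


/-! ## (v1.1, append-only) The binder and the door from SHARP-FORM flat faces -/

/-- ★★ **(v1.1) THE ANALYTIC INCLUSION `hreg` FROM PER-STEP SHARP-FORM FLAT LOCAL FACES** (faces asked only of densities continuous at every point off `O ∩ {¬Q∘Θ}` — the input shape that survives the window cuts of `HaarExpChartLocalFaceTransport` §8; `Node00.RegSetOfLocalFaces.subset_regSetOfRecord_of_flatLocalFaces'`).  Otherwise as the unprimed theorem:  For a Stage-13 parameter `θ`, a run `P`, an additive Haar
measure `η` on the Lie model, exemption predicates `Q j` and closed sets `K₀ j` of fine configurations: if every β-input density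
`ρ_j = betaInputOfRecord (TβOfRecord₁₃) (chiβOfRecord₁₃ θ) P.K (gOfRecord₁₃ θ P) j`, `j < P.K`, is measurable, `0 ≤ ρ_j ≤ C_j`, vanishes off
`K₀ j` and is continuous at each `U ∈ K₀ j` with `Q j U`, and at every `U₀ ∈ K₀ j` the averaging of record is continuous with the FLAT local face of
its chart reading at `0` (w.r.t. `⊗η`), then `domAltOfRecord θ.ν P.K (j+1) ⊆ regSetOfRecord F N P.K j ρ_j` for every `j < P.K` — the binder `hreg`
of the N09 doors VERBATIM (`Node00.RegSetOfLocalFaces.subset_regSetOfRecord_of_flatLocalFaces` at the open set `domAltOfRecord`).  The faces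
are displayed, not constructed. [cite: Balaban1987RG1, p.259, (2.10) p.267 and (0.13) p.254] -/
theorem hreg_of_flatLocalFaces' (θ : Stage13Params F N) (P : B12.RunParams)
    (η : Measure (specialUnitaryLogChart (Fin N)).lie) [η.IsAddHaarMeasure]
    (Q : ∀ j, GaugeField (F.P P.K) j (SU N) → Prop) (K₀ : ∀ j, Set (GaugeField (F.P P.K) j (SU N))) (hK₀ : ∀ j, IsClosed (K₀ j))
    (hρm : ∀ j < P.K, Measurable (betaInputOfRecord F N (TβOfRecord₁₃ F N) (chiβOfRecord₁₃ F N θ) P.K (gOfRecord₁₃ F N θ P) j))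
    (hρ0 : ∀ j < P.K, ∀ U, 0 ≤ betaInputOfRecord F N (TβOfRecord₁₃ F N) (chiβOfRecord₁₃ F N θ) P.K (gOfRecord₁₃ F N θ P) j U)
    (hρC : ∀ j < P.K, ∃ C₀ : ℝ, ∀ U, betaInputOfRecord F N (TβOfRecord₁₃ F N) (chiβOfRecord₁₃ F N θ) P.K (gOfRecord₁₃ F N θ P) j U ≤ C₀)
    (hρK : ∀ j < P.K, ∀ U, U ∉ K₀ j → betaInputOfRecord F N (TβOfRecord₁₃ F N) (chiβOfRecord₁₃ F N θ) P.K (gOfRecord₁₃ F N θ P) j U = 0)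
    (hρc : ∀ j < P.K, ∀ U ∈ K₀ j, Q j U →
      ContinuousAt (betaInputOfRecord F N (TβOfRecord₁₃ F N) (chiβOfRecord₁₃ F N θ) P.K (gOfRecord₁₃ F N θ P) j) U)
    (hface : ∀ j < P.K, ∀ U₀ ∈ K₀ j, ContinuousAt (avOfRecord F N P.K j).avg U₀ ∧
      ∃ O : Set (PBond (F.P P.K) j → (specialUnitaryLogChart (Fin N)).lie),
        ∃ D : Set (PBond (F.P P.K) (j + 1) → (specialUnitaryLogChart (Fin N)).lie),
        IsOpen O ∧ (0 : PBond (F.P P.K) j → (specialUnitaryLogChart (Fin N)).lie) ∈ O ∧ IsOpen D ∧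
        (0 : PBond (F.P P.K) (j + 1) → (specialUnitaryLogChart (Fin N)).lie) ∈ D ∧
        ∀ r : (PBond (F.P P.K) j → (specialUnitaryLogChart (Fin N)).lie) → ℝ, Measurable r → (∀ A, 0 ≤ r A) →
          (∀ A, (A ∈ O → Q j (fun b => (isChartRep_specialUnitaryGroup (n := Fin N)).expChart (A b) * U₀ b)) →
            ContinuousAt r A) →
          (∃ C₀ : ℝ, ∀ A, r A ≤ C₀) → (∀ A, A ∉ O → r A = 0) →
          ∃ I : (PBond (F.P P.K) (j + 1) → (specialUnitaryLogChart (Fin N)).lie) → ℝ, ContinuousOn I D ∧ (∀ w, 0 ≤ I w) ∧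
            ∀ A' : Set (PBond (F.P P.K) (j + 1) → (specialUnitaryLogChart (Fin N)).lie), MeasurableSet A' → A' ⊆ D →
              ((Measure.pi fun _ : PBond (F.P P.K) j => η).withDensity fun A => ENNReal.ofReal (r A))
                  ((fun (A : PBond (F.P P.K) j → (specialUnitaryLogChart (Fin N)).lie) (c : PBond (F.P P.K) (j + 1)) =>
                      (isChartRep_specialUnitaryGroup (n := Fin N)).logChart
                        ((avOfRecord F N P.K j).avg
                            (fun b => (isChartRep_specialUnitaryGroup (n := Fin N)).expChart (A b) * U₀ b) c *
                          ((avOfRecord F N P.K j).avg U₀ c)⁻¹)) ⁻¹' A') =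
                ∫⁻ w in A', ENNReal.ofReal (I w) ∂(Measure.pi fun _ : PBond (F.P P.K) (j + 1) => η)) :
    ∀ j < P.K, domAltOfRecord F N θ.ν P.K (j + 1) ⊆ regSetOfRecord F N P.K j
      (betaInputOfRecord F N (TβOfRecord₁₃ F N) (chiβOfRecord₁₃ F N θ) P.K (gOfRecord₁₃ F N θ P) j) :=
  fun j hj => subset_regSetOfRecord_of_flatLocalFaces' η hj (hρm j hj) (hρ0 j hj) (hρC j hj) (Q j) (hK₀ j) (hρK j hj) (hρc j hj)
    (hface j hj) (isOpen_domAltOfRecord θ.ν P.K (j + 1))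


/-- ★★★ **(v1.1) THE SAME DOOR WITH PER-STEP SHARP-FORM FLAT LOCAL FACES**
(`…N09B0RiderAtRecord.thm3Member_stage13SepCoPH_atDomAlt_of_numerics_of_εreg_eq` with `hreg := hreg_of_flatLocalFaces …` and (I19) `hint`
derived from boundedness + measurability): N09's Theorem-3 member at the Stage-13 record from (181)ˢᵒˡ `hcov`, `hsolν` + [B11] ×3 at one
radius (N07), NUMERICS on the record's letters, and — in place of the analytic inclusion — per step `j < P.K`: the β-input density measurable,
`0 ≤ ρ_j ≤ C_j`, vanishing off a closed `K₀ j`, continuous at the non-exempt points, and at every fine configuration of `K₀ j` the FLAT LOCAL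
FACE of the chart-read averaging of record at `0` (displayed, not constructed).  CONDITIONAL; nothing of Bałaban's asserted; N09 NOT discharged.
[cite: Balaban1987RG1, Thm 3 p.264, p.259, (2.9) p.266, (2.10) p.267; Balaban1985Variational, Thm 1 (8)–(10) p.279 and (181) p.307] -/
theorem thm3Member_stage13SepCoPH_atDomAlt_of_sharpFlatLocalFaces_of_numerics_of_εreg_eq (θ : Stage13HParams F N)
    (h : θ.Provisos₁₃SepCoPH F N)
    {w : WorldP} (hC : w.C = (datumOfRecord₁₃SepCoPH F N θ h).C) (P : B12.RunParams) (hε : 0 < θ.ε₂₉) (heq : θ.toStage13Params.ν.εreg = θ.εbg)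
    (hεreg : 0 < θ.toStage13Params.ν.εreg)
    (hε3 : (143 * (((((F.P P.K).d + 4 : ℕ) : ℝ)) ^ 2 / 4) ^ 2) * θ.toStage13Params.ν.εreg ≤ 1 / 3)
    (hε2 : 2 * θ.toStage13Params.ν.εreg ≤ 2 * deltaSU (Fin N) / ((((F.P P.K).d + 4) * (F.P P.K).L : ℕ) : ℝ) ^ 2)
    (hord : 2 * θ.toStage13Params.ν.εreg / ((F.P P.K).L : ℝ) ^ 2 +
      4 * max θ.toStage13Params.ε₂₉ (10 * (((((F.P P.K).d + 2) * (F.P P.K).L : ℕ) : ℝ) * θ.toStage13Params.ε₂₉) * ((F.P P.K).L : ℝ) ^ ((F.P P.K).d - 1)) ≤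
        θ.toStage13Params.ν.ε₀)
    (hn1 : 1640 * (2 * (((((F.P P.K).d + 2) * (F.P P.K).L : ℕ) : ℝ) * θ.toStage13Params.ε₂₉) +
        ((((F.P P.K).d + 2) * (F.P P.K).L : ℕ) : ℝ) ^ 2 / 4 * (2 * θ.toStage13Params.ν.εreg / ((F.P P.K).L : ℝ) ^ 2)) *
          (((F.P P.K).L : ℝ) ^ ((F.P P.K).d - 1)) ^ 2 ≤ 1)
    (hn2 : 13 * (2 * (((((F.P P.K).d + 2) * (F.P P.K).L : ℕ) : ℝ) * θ.toStage13Params.ε₂₉) +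
        ((((F.P P.K).d + 2) * (F.P P.K).L : ℕ) : ℝ) ^ 2 / 4 * (2 * θ.toStage13Params.ν.εreg / ((F.P P.K).L : ℝ) ^ 2)) *
          ((F.P P.K).L : ℝ) ^ ((F.P P.K).d - 1) < deltaSU (Fin N))
    (hcov : ∀ j < P.K, ∀ (v : GaugeTransf (F.P P.K) (j + 1) (SU N)) (W : GaugeField (F.P P.K) (j + 1) (SU N)),
      UkExists F N P.K (j + 1) θ.toStage13Params.ν.εreg W →
        critCfgOfRecord F N θ.toStage13Params.ν P.K j (gaugeAct v W) = gaugeAct (liftTransf v) (critCfgOfRecord F N θ.toStage13Params.ν P.K j W))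
    (hsolν : ∀ j < P.K, ∀ W ∈ domAltOfRecord F N θ.ν P.K (j + 1), UkExists F N P.K (j + 1) θ.toStage13Params.ν.εreg W)
    (η : Measure (specialUnitaryLogChart (Fin N)).lie) [η.IsAddHaarMeasure]
    (Q : ∀ j, GaugeField (F.P P.K) j (SU N) → Prop) (K₀ : ∀ j, Set (GaugeField (F.P P.K) j (SU N))) (hK₀ : ∀ j, IsClosed (K₀ j))
    (hρm : ∀ j < P.K, Measurable (betaInputOfRecord F N (TβOfRecord₁₃ F N) (chiβOfRecord₁₃ F N θ.toStage13Params) P.K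
      (gOfRecord₁₃ F N θ.toStage13Params P) j))
    (hρ0 : ∀ j < P.K, ∀ U, 0 ≤ betaInputOfRecord F N (TβOfRecord₁₃ F N) (chiβOfRecord₁₃ F N θ.toStage13Params) P.K
      (gOfRecord₁₃ F N θ.toStage13Params P) j U)
    (hρC : ∀ j < P.K, ∃ C₀ : ℝ, ∀ U, betaInputOfRecord F N (TβOfRecord₁₃ F N) (chiβOfRecord₁₃ F N θ.toStage13Params) P.K
      (gOfRecord₁₃ F N θ.toStage13Params P) j U ≤ C₀)
    (hρK : ∀ j < P.K, ∀ U, U ∉ K₀ j → betaInputOfRecord F N (TβOfRecord₁₃ F N) (chiβOfRecord₁₃ F N θ.toStage13Params) P.K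
      (gOfRecord₁₃ F N θ.toStage13Params P) j U = 0)
    (hρc : ∀ j < P.K, ∀ U ∈ K₀ j, Q j U → ContinuousAt (betaInputOfRecord F N (TβOfRecord₁₃ F N)
      (chiβOfRecord₁₃ F N θ.toStage13Params) P.K (gOfRecord₁₃ F N θ.toStage13Params P) j) U)
    (hface : ∀ j < P.K, ∀ U₀ ∈ K₀ j, ContinuousAt (avOfRecord F N P.K j).avg U₀ ∧
      ∃ O : Set (PBond (F.P P.K) j → (specialUnitaryLogChart (Fin N)).lie),
        ∃ D : Set (PBond (F.P P.K) (j + 1) → (specialUnitaryLogChart (Fin N)).lie),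
        IsOpen O ∧ (0 : PBond (F.P P.K) j → (specialUnitaryLogChart (Fin N)).lie) ∈ O ∧ IsOpen D ∧
        (0 : PBond (F.P P.K) (j + 1) → (specialUnitaryLogChart (Fin N)).lie) ∈ D ∧
        ∀ r : (PBond (F.P P.K) j → (specialUnitaryLogChart (Fin N)).lie) → ℝ, Measurable r → (∀ A, 0 ≤ r A) →
          (∀ A, (A ∈ O → Q j (fun b => (isChartRep_specialUnitaryGroup (n := Fin N)).expChart (A b) * U₀ b)) →
            ContinuousAt r A) →
          (∃ C₀ : ℝ, ∀ A, r A ≤ C₀) → (∀ A, A ∉ O → r A = 0) →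
          ∃ I : (PBond (F.P P.K) (j + 1) → (specialUnitaryLogChart (Fin N)).lie) → ℝ, ContinuousOn I D ∧ (∀ w, 0 ≤ I w) ∧
            ∀ A' : Set (PBond (F.P P.K) (j + 1) → (specialUnitaryLogChart (Fin N)).lie), MeasurableSet A' → A' ⊆ D →
              ((Measure.pi fun _ : PBond (F.P P.K) j => η).withDensity fun A => ENNReal.ofReal (r A))
                  ((fun (A : PBond (F.P P.K) j → (specialUnitaryLogChart (Fin N)).lie) (c : PBond (F.P P.K) (j + 1)) =>
                      (isChartRep_specialUnitaryGroup (n := Fin N)).logChart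
                        ((avOfRecord F N P.K j).avg
                            (fun b => (isChartRep_specialUnitaryGroup (n := Fin N)).expChart (A b) * U₀ b) c *
                          ((avOfRecord F N P.K j).avg U₀ c)⁻¹)) ⁻¹' A') =
                ∫⁻ w in A', ENNReal.ofReal (I w) ∂(Measure.pi fun _ : PBond (F.P P.K) (j + 1) => η))
    (h11 : ∀ k, k ≤ P.K → ∀ V ∈ domAltOfRecord F N θ.ν P.K k, UkExists F N P.K k θ.εbg V ∧ UniqueUkOrbit F N P.K k θ.εbg V)
    (hres : ∀ k, k ≤ P.K → HRestrict F N θ.εbg P.K k (domAltOfRecord F N θ.ν P.K k))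
    (huniq : ∀ k, k ≤ P.K → ∀ V ∈ domAltOfRecord F N θ.ν P.K k, ∀ j < k,
      UniqueUkOrbit F N P.K (j + 1) θ.εbg (Averaging.iter (avOfRecord F N P.K) (j + 1) (Uk F N P.K k θ.εbg V))) :
    (leavesP w P).smallCouplings → (leavesP w P).smallFieldInductive := by
  have hint : ∀ j < P.K, Integrable (betaInputOfRecord F N (TβOfRecord₁₃ F N) (chiβOfRecord₁₃ F N θ.toStage13Params) P.K
      (gOfRecord₁₃ F N θ.toStage13Params P) j) (fieldMeasure (F.P P.K) j (SU N)) := by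
    intro j hj
    obtain ⟨C₀, hC₀⟩ := hρC j hj
    refine Integrable.of_bound (hρm j hj).aestronglyMeasurable C₀ (Filter.Eventually.of_forall fun U => ?_)
    rw [Real.norm_eq_abs, abs_of_nonneg (hρ0 j hj U)]
    exact hC₀ U
  exact thm3Member_stage13SepCoPH_atDomAlt_of_numerics_of_εreg_eq θ h hC P hε heq hεreg hε3 hε2 hord hn1 hn2 hcov hsolν hint
    (hreg_of_flatLocalFaces' θ.toStage13Params P η Q K₀ hK₀ hρm hρ0 hρC hρK hρc hface) h11 hres huniq


end Summit.QuantumFields.YangMills.BalabanUVNodes.N09HregOfLocalFacesAtRecord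

end
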